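import Summits.CriticalPhenomena.Ising3DConformalLimit.Theorems.IsingEuclidUpgradeR4NonGaussianBackboneCutDecomposition
import HarnessLib

/-!
# Crux `IsingEuclidUpgradeR4NonGaussian` (stmt-CriticalPhenomena-0636), line `partner-backbone-cut`:
# the mean helper-assisted capacity of the partner's backbone is bounded by the tree diagram

Calibration of the open Stub 3 (R) `stub_partnerBackboneRough`, which asks the helper-assisted
`σσ`-capacity `A⁺(δ)/(Z[xy]Z[∅]) = Σ_{u ∈ vis δ} ⟨σ_xσ_u⟩⟨σ_uσ_y⟩/⟨σ_xσ_y⟩` of the explored backbone `δ`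
of the `{z,t}`-current to exceed every level `M` with probability `≥ 1/2`. This file bounds its MEAN by
the tree diagram (finite graph, couplings `K ≥ 0`, injective ranking):

`sum_patSum_mul_fullFirstMoment_vis_le` —
`(Σ_{δ ∈ finalStates(z→t)} patSum(δ) · Z_{K off δ.used}[∅] · A⁺(δ.vis)) · Z[∅] ≤ Σ_u Z[xu] Z[uy] · Z[zu] Z[ut]`,
i.e. `E^{zt}[Σ_{u ∈ vis δ} ⟨σ_xσ_u⟩⟨σ_uσ_y⟩] ≤ Σ_u ⟨σ_xσ_u⟩⟨σ_uσ_y⟩⟨σ_zσ_u⟩⟨σ_uσ_t⟩/⟨σ_zσ_t⟩` (chain rule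
for the visited set, `Current.tsum_backboneVisits_mul_le`, summed against the capacity kernel). With the
two-point function regularly varying of index `-2Δ` at scale `R = 1/δ` the right side is `≍ R^{3-4Δ}·⟨σ_xσ_y⟩`,
bounded at the marginal exponent `Δ = 3/4`: by Markov, (R) in its `∀ M` form forces `Δ < 3/4` (the line's
version of the marginal exclusion), see `Lines/partner-backbone-cut-dead.md`.

References: M. Aizenman, Comm. Math. Phys. 86 (1982) §5 (tree diagram), §9; M. Aizenman, H. Duminil-Copin,
Ann. Math. 194 (2021) = arXiv:1912.07973 §6.2 (6.11) (chain rule for backbones).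
-/

noncomputable section

namespace Summit.CriticalPhenomena.Ising3DConformalLimit.Cruxes.IsingEuclidUpgradeR4NonGaussian.PartnerBackboneCut

open Literature.Probability Literature.Probability.LatticeModels Literature.Probability.Percolation
open MeasureTheory Filter Finset Current
open scoped Topology symmDiff ENNReal

variable {V : Type*} [Fintype V] [DecidableEq V] {G : SimpleGraph V} [DecidableRel G.Adj]

/-- **The backbone decomposition of a visit indicator**: for a site `u`,
`Σ_{δ ∈ finalStates(z→t)} patSum(δ)·Z_{K off δ.used}[∅]·1[u ∈ δ.vis] = Σ_n 1{∂n={z}Δ{t}} w(n) 1[u ∈ vis(walk of n)]`.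
[cite: AizenmanCMP1982, Prop. 9.2, eq. (9.8)] -/
theorem sum_patSum_mul_koff_mul_indicator_vis {K : G.edgeFinset → ℝ} (hK : ∀ e, 0 ≤ K e)
    {rk : G.edgeFinset → ℕ} (hrk : Function.Injective rk) (z t u : V) :
    ∑ δ ∈ finalStates rk {t} z t,
        patSum K δ * ecurrentSum (koff K δ.used) ∅ * (if u ∈ δ.vis then 1 else 0) =
      ∑' n : Current G, (if n.sources = {z} ∆ {t} then n.eweight K else 0) *
        (if u ∈ (explore rk n {t} z).vis then 1 else 0) := by
  have hδsum : ∀ δ ∈ finalStates rk {t} z t,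
      patSum K δ * ecurrentSum (koff K δ.used) ∅ * (if u ∈ δ.vis then 1 else 0) =
        ∑' n : Current G, ((if n.sources = {z} ∆ {t} then n.eweight K else 0) *
          (if u ∈ (explore rk n {t} z).vis then 1 else 0)) * (if InCyl δ n then 1 else 0) := by
    intro δ hδ
    obtain ⟨-, n₀, hδ'⟩ := mem_finalStates_iff.1 hδ
    have h := tsum_inCyl_of_mem_finalStates hK hrk hδ ({z} ∆ {t})
    have h0 : ({z} ∆ {t}) ∆ ({z} ∆ {t}) = (∅ : Finset V) := by rw [symmDiff_self]; rfl
    rw [h0] at h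
    rw [← h, ← ENNReal.tsum_mul_right]
    refine tsum_congr fun n => ?_
    by_cases hc : InCyl δ n
    · have hex : explore rk n {t} z = δ := by
        rw [hδ']; exact (explore_eq_iff_inCyl hrk).2 (hδ' ▸ hc)
      rw [if_pos hc, hex]; ring
    · rw [if_neg hc]; ring
  rw [Finset.sum_congr rfl hδsum, ← tsum_mul_indicator_pos_eq_sum (Y := {t}) hrk _ z t]
  refine tsum_congr fun n => ?_
  by_cases hs : n.sources = {z} ∆ {t}
  · rw [if_pos (explore_done_of_sources_eq hrk hs).2, mul_one]
  · simp [hs]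

/-- **The mean helper-assisted capacity of the explored backbone is at most the tree diagram**
(finite graph, `K ≥ 0`, injective ranking, vertices `x y z t`):
`(Σ_{δ ∈ finalStates(z→t)} patSum(δ)·Z_{K off δ.used}[∅]·fullFirstMoment(δ.vis)) · Z[∅]
  ≤ Σ_u (Z[{x}Δ{u}] Z[{y}Δ{u}]) · (Z[{z}Δ{u}] Z[{u}Δ{t}])`, i.e.
`E^{zt}[Σ_{u ∈ vis δ} ⟨σ_xσ_u⟩⟨σ_uσ_y⟩] ≤ Σ_u ⟨σ_xσ_u⟩⟨σ_uσ_y⟩⟨σ_zσ_u⟩⟨σ_uσ_t⟩ / ⟨σ_zσ_t⟩`.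
(Chain rule for the visited set, Aizenman–Duminil-Copin 2021 (6.11), against the capacity kernel.)
[cite: AizenmanDuminilCopinAnnals2021, arXiv:1912.07973 §6.2 (6.11)] -/
theorem sum_patSum_mul_fullFirstMoment_vis_le {K : G.edgeFinset → ℝ} (hK : ∀ e, 0 ≤ K e)
    {rk : G.edgeFinset → ℕ} (hrk : Function.Injective rk) (x y z t : V) :
    (∑ δ ∈ finalStates rk {t} z t,
        patSum K δ * ecurrentSum (koff K δ.used) ∅ * fullFirstMoment K δ.vis x y) * ecurrentSum K ∅ ≤
      ∑ u, (ecurrentSum K ({x} ∆ {u}) * ecurrentSum K ({y} ∆ {u})) *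
        (ecurrentSum K ({z} ∆ {u}) * ecurrentSum K ({u} ∆ {t})) := by
  classical
  -- rewrite the capacity of `δ.vis` as a sum over all sites with a visit indicator
  have hfull : ∀ δ : XState G, fullFirstMoment K δ.vis x y =
      ∑ u, (ecurrentSum K ({x} ∆ {u}) * ecurrentSum K ({y} ∆ {u})) * (if u ∈ δ.vis then 1 else 0) := by
    intro δ
    unfold fullFirstMoment
    simp only [mul_boole]
    rw [Finset.sum_ite_mem, Finset.univ_inter]
  simp_rw [hfull, Finset.mul_sum]
  rw [Finset.sum_comm, Finset.sum_mul]
  refine Finset.sum_le_sum fun u _ => ?_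
  -- for a fixed site `u`: the decomposition of the visit indicator, then the chain rule
  have hvis := tsum_backboneVisits_mul_le hK hrk ({t} : Finset V) z t ({u} : Finset V)
  have hind : ∀ n : Current G,
      (if ((explore rk n {t} z).vis ∩ {u}).Nonempty then (1 : ℝ≥0∞) else 0) =
        (if u ∈ (explore rk n {t} z).vis then 1 else 0) := by
    intro n
    by_cases hu : u ∈ (explore rk n {t} z).vis
    · rw [if_pos hu, if_pos ⟨u, Finset.mem_inter.2 ⟨hu, Finset.mem_singleton_self u⟩⟩]
    · rw [if_neg hu, if_neg]
      rintro ⟨v, hv⟩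
      rw [Finset.mem_inter, Finset.mem_singleton] at hv
      exact hu (hv.2 ▸ hv.1)
  simp_rw [hind] at hvis
  rw [Finset.sum_singleton] at hvis
  calc (∑ δ ∈ finalStates rk {t} z t, patSum K δ * ecurrentSum (koff K δ.used) ∅ *
          ((ecurrentSum K ({x} ∆ {u}) * ecurrentSum K ({y} ∆ {u})) * (if u ∈ δ.vis then 1 else 0))) *
          ecurrentSum K ∅
      = (ecurrentSum K ({x} ∆ {u}) * ecurrentSum K ({y} ∆ {u})) *
          ((∑ δ ∈ finalStates rk {t} z t,
            patSum K δ * ecurrentSum (koff K δ.used) ∅ * (if u ∈ δ.vis then 1 else 0)) * ecurrentSum K ∅) := by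
        rw [Finset.sum_mul, Finset.sum_mul, Finset.mul_sum]
        refine Finset.sum_congr rfl fun δ _ => ?_
        ring
    _ ≤ (ecurrentSum K ({x} ∆ {u}) * ecurrentSum K ({y} ∆ {u})) *
          (ecurrentSum K ({z} ∆ {u}) * ecurrentSum K ({u} ∆ {t})) := by
        refine mul_le_mul' le_rfl ?_
        rw [sum_patSum_mul_koff_mul_indicator_vis hK hrk z t u]
        exact hvis


/-- **Registered calibration sub-goal `stub_backboneCapacityMean`** (explicit form of
`sum_patSum_mul_fullFirstMoment_vis_le`): the mean helper-assisted capacity of the explored backbone of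
the `{z,t}`-current is at most the tree diagram, for every finite graph, couplings `K ≥ 0`, injective
ranking and vertices `x y z t`. [cite: AizenmanDuminilCopinAnnals2021, arXiv:1912.07973 §6.2 (6.11)] -/
theorem stub_backboneCapacityMean :
    ∀ (V : Type) [Fintype V] [DecidableEq V] (G : SimpleGraph V) [DecidableRel G.Adj]
      (K : G.edgeFinset → ℝ), (∀ e, 0 ≤ K e) → ∀ (rk : G.edgeFinset → ℕ), Function.Injective rk →
      ∀ (x y z t : V),
        (∑ δ ∈ Current.finalStates rk {t} z t,
            patSum K δ * ecurrentSum (koff K δ.used) ∅ * fullFirstMoment K δ.vis x y) * ecurrentSum K ∅ ≤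
          ∑ u, (ecurrentSum K ({x} ∆ {u}) * ecurrentSum K ({y} ∆ {u})) *
            (ecurrentSum K ({z} ∆ {u}) * ecurrentSum K ({u} ∆ {t})) :=
  fun _ _ _ _ _ _ hK _ hrk x y z t => sum_patSum_mul_fullFirstMoment_vis_le hK hrk x y z t

end Summit.CriticalPhenomena.Ising3DConformalLimit.Cruxes.IsingEuclidUpgradeR4NonGaussian.PartnerBackboneCut
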